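import Summits.AnomalousDissipation.AnomalousDissipation.Theorems.SolenoidalFractalHomogenisationLagrangianStepCellClauseModDefs
import Literature.Analysis.FluidPDE.PassiveVectorTensorDistortedDuality
import Literature.Analysis.FunctionSpaces.TorusEnstrophyOrthogonality
import HarnessLib

/-!
# K1L_D (stmt-AnomalousDissipation-27980), (ℓ3): CONSTANT FIELDS ARE INVISIBLE TO THE DISTORTED CLASS — the kernel form of the
# index reconciliation of RULING D28-8′ (memo L21 §1; prover lead-k1l-onelevel-p1 g7; helper, `--supports 27980 --as helper`)

CONVENTION (line 1 of every (ℓ3) memo, per D28-8′): the tree's distortion is a DERIVATIVE-INDEX conjugation —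
`Torus.Visc4.conj M 𝔸 i c j e = Σ_{a,b} M c a * 𝔸 i a j b * M e b` and `Torus.viscAdjVar 𝔹 Ψ = Σ_j (Σ_{i,c,e} ∂_e(𝔹 i c j e · (∂_c Ψ)_i)) e_j`;
the class variable is `v = u ∘ X` (components NOT rotated) and `Torus.distort G v = G · v` enters ONLY the constraint `∇·(G v) = 0`.

Consequences recorded here (all elementary; they are what makes memo L20 §2's two-mode family (slow datum `xs = e₂`) satisfy
(M_θ) `VmodDist.NearMultG` TRIVIALLY instead of refuting it — RULING D28-8′ (1), certifier 3-probe `Lines/onelevel-nearmult-probe.md`):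
* `convect_const_field`, `viscAdjVar_const_field` — every term of the distorted test operator annihilates a constant field: `(b·∇)c = 0`,
  `𝓛^{𝔹,*} c = 0` for EVERY `y`-dependent coefficient tensor `𝔹` (no `∇G·c` term exists in the tree's form);
* `isDivFree_distort_const` — a constant field `c` is `G`-solenoidal as soon as the columns of `G` are divergence free (Piola,
  `IsModulation.piola`): `∇·(G c) = Σ_i c_i ∇·(G e_i) = 0`;
* **`IsWeakTensorPassiveVectorDistortedOn.ae_integral_inner_const_eq`** — MEAN CONSERVATION: for every distorted weak solution `w` (any
  coupling `A`, any tensor, any carrier, any modulation `G` whose columns are divergence free at all times) and every constant `c`,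
  `∫⟪w t, c⟫ = ∫⟪w₀, c⟫` for a.e. `t` (the space–time pairing identity `ae_integral_inner_lipschitzField_eq` with the steady test `c`);
* `ae_integral_inner_const_eq_zero` — in particular a datum orthogonal to the constants (e.g. L20's fast partner `xf`) stays orthogonal:
  the cross term `⟪c, w t⟫` of L20 §2 vanishes identically.
No sorry, no new definition, no named fact.  NOT a proof of (M_θ), of `stub_Vmod_EHTthg`, of K1L_D or of AD; rung F-D1.A0.
-/

set_option linter.dupNamespace false

noncomputable section

namespace Summit.AnomalousDissipation.AnomalousDissipation.Theorems.SolenoidalFractalHomogenisation.LagrangianStep.CellClauseMod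

open Literature.Analysis Literature.Analysis.FluidPDE Literature.Analysis.FunctionSpaces
open MeasureTheory Set Filter Function UnitAddTorus
open scoped ENNReal NNReal InnerProductSpace

variable {d : Type*} [Fintype d] [DecidableEq d]

/-! ## §1 The distorted test operator annihilates constants -/

omit [Fintype d] [DecidableEq d] in
/-- The torus Fréchet derivative of a constant field vanishes. -/
theorem fderiv_const_field {F : Type*} [NormedAddCommGroup F] [NormedSpace ℝ F] (c : F) (x : UnitAddTorus d) :
    Torus.fderiv (fun _ : UnitAddTorus d => c) x = 0 := by
  unfold Torus.fderiv
  rw [show Torus.liftAt (fun _ : UnitAddTorus d => c) x = fun _ => c from rfl]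
  exact _root_.fderiv_const_apply c

omit [Fintype d] [DecidableEq d] in
/-- `(b·∇)c = 0` for a constant field `c` (any carrier `b`). -/
theorem convect_const_field {F : Type*} [NormedAddCommGroup F] [NormedSpace ℝ F] (b : UnitAddTorus d → EuclideanSpace ℝ d) (c : F)
    (x : UnitAddTorus d) : Torus.convect b (fun _ : UnitAddTorus d => c) x = 0 := by
  unfold Torus.convect
  rw [fderiv_const_field]
  rfl

omit [Fintype d] in
/-- Partial derivatives of a constant field vanish. -/
theorem partialDeriv_const_field {F : Type*} [NormedAddCommGroup F] [NormedSpace ℝ F] (i : d) (c : F) (x : UnitAddTorus d) :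
    Torus.partialDeriv i (fun _ : UnitAddTorus d => c) x = 0 := by
  simp [Torus.partialDeriv, Torus.lineDeriv]

/-- **`𝓛^{𝔹,*} c = 0`**: the divergence-form test operator with ANY `y`-dependent coefficient tensor annihilates a constant field
(the inner derivative `∂_c` falls on the constant; no `∇G · c` term exists in the tree's derivative-index form). -/
theorem viscAdjVar_const_field (𝔹 : UnitAddTorus d → Torus.Visc4 d) (c : EuclideanSpace ℝ d) (x : UnitAddTorus d) :
    Torus.viscAdjVar 𝔹 (fun _ : UnitAddTorus d => c) x = 0 := by
  rw [Torus.viscAdjVar]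
  refine Finset.sum_eq_zero fun j _ => ?_
  have h0 : (∑ i, ∑ c', ∑ e, Torus.partialDeriv e (fun y => 𝔹 y i c' j e * (Torus.partialDeriv c' (fun _ : UnitAddTorus d => c) y) i) x) = 0 := by
    refine Finset.sum_eq_zero fun i _ => Finset.sum_eq_zero fun c' _ => Finset.sum_eq_zero fun e _ => ?_
    have hz : (fun y => 𝔹 y i c' j e * (Torus.partialDeriv c' (fun _ : UnitAddTorus d => c) y) i) = fun _ => (0:ℝ) := by
      funext y
      rw [partialDeriv_const_field, PiLp.zero_apply, mul_zero]
    rw [hz, partialDeriv_const_field]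
  rw [h0, zero_smul]

/-! ## §2 Constants are `G`-solenoidal when the columns of `G` are divergence free (Piola) -/

omit [DecidableEq d] in
/-- The `G`-distortion of a constant field is the constant combination of the columns of `G`: `G c = Σ_i c_i • (G e_i)`. -/
theorem distort_const_eq_sum (G : UnitAddTorus d → Matrix d d ℝ) (c : EuclideanSpace ℝ d) :
    Torus.distort G (fun _ : UnitAddTorus d => c)
      = fun y => ∑ i, c i • (WithLp.toLp 2 fun c' => G y c' i : EuclideanSpace ℝ d) := by
  funext y
  ext c'
  rw [Torus.distort_apply]
  simp only [WithLp.ofLp_sum, WithLp.ofLp_smul, Finset.sum_apply, Pi.smul_apply, smul_eq_mul]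
  exact Finset.sum_congr rfl fun i _ => by ring

/-- **Piola ⇒ constants are `G`-solenoidal**: if every column `y ↦ G(y) e_i` is smooth and divergence free, then `∇·(G c) = 0` for every
constant field `c`. -/
theorem isDivFree_distort_const {G : UnitAddTorus d → Matrix d d ℝ}
    (hsmooth : ∀ i j, Torus.IsSmooth (fun y => G y i j))
    (hcol : ∀ i, Torus.IsDivFree (fun y => (WithLp.toLp 2 fun c' => G y c' i : EuclideanSpace ℝ d))) (c : EuclideanSpace ℝ d) :
    Torus.IsDivFree (Torus.distort G (fun _ : UnitAddTorus d => c)) := by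
  rw [distort_const_eq_sum]
  intro x
  -- each column is `C¹`
  have hcol1 : ∀ i, Torus.IsContDiff 1 (fun y => (WithLp.toLp 2 fun c' => G y c' i : EuclideanSpace ℝ d)) := by
    intro i
    have hs : Torus.IsSmooth (fun y => (WithLp.toLp 2 fun c' => G y c' i : EuclideanSpace ℝ d)) := by
      unfold Torus.IsSmooth
      rw [contDiff_piLp (𝕜 := ℝ) 2]
      intro c'
      exact hsmooth c' i
    exact hs.isContDiff (by simp)
  rw [Torus.divergence]
  have hcoord : ∀ i j, Torus.IsContDiff 1 (fun y => (WithLp.toLp 2 fun c' => G y c' i : EuclideanSpace ℝ d) j) := fun i j =>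
    (EuclideanSpace.proj j : EuclideanSpace ℝ d →L[ℝ] ℝ).contDiff.comp (hcol1 i)
  have hcoord' : ∀ i j, Torus.IsContDiff 1 (fun y => c i * (WithLp.toLp 2 fun c' => G y c' i : EuclideanSpace ℝ d) j) := fun i j => by
    unfold Torus.IsContDiff at *
    exact contDiff_const.mul (hcoord i j)
  have hrw : ∀ j, Torus.partialDeriv j (fun y => (∑ i, c i • (WithLp.toLp 2 fun c' => G y c' i : EuclideanSpace ℝ d)) j) x
      = ∑ i, c i * Torus.partialDeriv j (fun y => (WithLp.toLp 2 fun c' => G y c' i : EuclideanSpace ℝ d) j) x := by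
    intro j
    have h1 : (fun y => (∑ i, c i • (WithLp.toLp 2 fun c' => G y c' i : EuclideanSpace ℝ d)) j)
        = fun y => ∑ i, c i * (WithLp.toLp 2 fun c' => G y c' i : EuclideanSpace ℝ d) j := by
      funext y
      simp only [WithLp.ofLp_sum, WithLp.ofLp_smul, Finset.sum_apply, Pi.smul_apply, smul_eq_mul]
    rw [h1, Torus.partialDeriv_finset_sum _ (fun i _ => hcoord' i j)]
    refine Finset.sum_congr rfl fun i _ => ?_
    rw [show (fun y => c i * (WithLp.toLp 2 fun c' => G y c' i : EuclideanSpace ℝ d) j)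
        = c i • (fun y => (WithLp.toLp 2 fun c' => G y c' i : EuclideanSpace ℝ d) j) from rfl,
      Torus.partialDeriv_const_smul (hcoord i j)]
    rfl
  simp_rw [hrw]
  rw [Finset.sum_comm]
  refine Finset.sum_eq_zero fun i _ => ?_
  rw [← Finset.mul_sum]
  have := hcol i x
  rw [Torus.divergence] at this
  rw [this, mul_zero]

/-! ## §3 Mean conservation for the distorted class -/

variable {A T : ℝ} {𝔸 : Torus.Visc4 d} {b : ℝ → UnitAddTorus d → EuclideanSpace ℝ d}
  {G : ℝ → UnitAddTorus d → Matrix d d ℝ} {w₀ : UnitAddTorus d → EuclideanSpace ℝ d} {w : ℝ → UnitAddTorus d → EuclideanSpace ℝ d}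

/-- **MEAN CONSERVATION for the distorted weak class.**  For every distorted weak solution and every constant field `c` that is
`G(t)`-solenoidal at all times (Piola: `isDivFree_distort_const`): `∫⟪w t, c⟫ = ∫⟪w₀, c⟫` for a.e. `t ∈ (0,T)`.  (The steady test `c` has
`∂_t c = 0`, `(b·∇)c = 0`, `𝓛^{G,*}_𝔸 c = 0`, and the coupling term `A⟪b, (w·∇)c⟫` vanishes too.) -/
theorem _root_.Literature.Analysis.FluidPDE.Torus.IsWeakTensorPassiveVectorDistortedOn.ae_integral_inner_const_eq
    (h : Torus.IsWeakTensorPassiveVectorDistortedOn A T 𝔸 b G w₀ w) (c : EuclideanSpace ℝ d)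
    (hc : ∀ t, Torus.IsDivFree (Torus.distort (G t) (fun _ : UnitAddTorus d => c))) :
    ∀ᵐ t ∂(volume.restrict (Ioo 0 T)), ∫ x, ⟪w t x, c⟫_ℝ = ∫ x, ⟪w₀ x, c⟫_ℝ := by
  have hψs : ∀ t : ℝ, Torus.IsSmooth ((fun (_ : ℝ) (_ : UnitAddTorus d) => c) t) := fun _ => Torus.isSmooth_const c
  have hψc : ∀ l : List d, Continuous (uncurry fun (t : ℝ) (y : UnitAddTorus d) =>
      Torus.iterPartialDeriv l ((fun (_ : ℝ) (_ : UnitAddTorus d) => c) t) y) := by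
    intro l
    cases l with
    | nil => exact continuous_const
    | cons i l =>
      have hz := Torus.iterPartialDeriv_const (d := d) c (i :: l) (List.cons_ne_nil i l)
      simp only [hz, Pi.zero_apply]
      exact continuous_const
  have hψL : ∃ L : ℝ, 0 ≤ L ∧ ∀ t ∈ Icc 0 T, ∀ s ∈ Icc 0 T, ∀ y : UnitAddTorus d,
      ‖(fun (_ : ℝ) (_ : UnitAddTorus d) => c) t y - (fun (_ : ℝ) (_ : UnitAddTorus d) => c) s y‖ ≤ L * |t - s| :=
    ⟨0, le_rfl, fun t _ s _ y => by simp⟩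
  have hψ' : ∀ᵐ t ∂(volume.restrict (Ioo 0 T)), ∀ y : UnitAddTorus d,
      HasDerivAt (fun s : ℝ => (fun (_ : ℝ) (_ : UnitAddTorus d) => c) s y) ((fun (_ : ℝ) (_ : UnitAddTorus d) => (0 : EuclideanSpace ℝ d)) t y) t :=
    ae_of_all _ fun t y => hasDerivAt_const t c
  -- the space–time integrand vanishes identically
  have hzero : ∀ (t : ℝ) (x : UnitAddTorus d),
      ⟪w t x, (fun (_ : ℝ) (_ : UnitAddTorus d) => (0 : EuclideanSpace ℝ d)) t x
          + Torus.convect (b t) ((fun (_ : ℝ) (_ : UnitAddTorus d) => c) t) x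
          + Torus.viscAdjVar (fun y => Torus.Visc4.conj (G t y) 𝔸) ((fun (_ : ℝ) (_ : UnitAddTorus d) => c) t) x⟫_ℝ
        + A * ⟪b t x, Torus.convect (w t) ((fun (_ : ℝ) (_ : UnitAddTorus d) => c) t) x⟫_ℝ = 0 := by
    intro t x
    rw [show ((fun (_ : ℝ) (_ : UnitAddTorus d) => c) t) = fun _ : UnitAddTorus d => c from rfl,
      convect_const_field, convect_const_field, viscAdjVar_const_field]
    simp
  have hint : Integrable (fun p : ℝ × UnitAddTorus d =>
      ⟪w p.1 p.2, (fun (_ : ℝ) (_ : UnitAddTorus d) => (0 : EuclideanSpace ℝ d)) p.1 p.2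
          + Torus.convect (b p.1) ((fun (_ : ℝ) (_ : UnitAddTorus d) => c) p.1) p.2
          + Torus.viscAdjVar (fun y => Torus.Visc4.conj (G p.1 y) 𝔸) ((fun (_ : ℝ) (_ : UnitAddTorus d) => c) p.1) p.2⟫_ℝ
        + A * ⟪b p.1 p.2, Torus.convect (w p.1) ((fun (_ : ℝ) (_ : UnitAddTorus d) => c) p.1) p.2⟫_ℝ)
      (((volume : Measure ℝ).restrict (Ioo 0 T)).prod volume) := by
    have : (fun p : ℝ × UnitAddTorus d =>
      ⟪w p.1 p.2, (fun (_ : ℝ) (_ : UnitAddTorus d) => (0 : EuclideanSpace ℝ d)) p.1 p.2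
          + Torus.convect (b p.1) ((fun (_ : ℝ) (_ : UnitAddTorus d) => c) p.1) p.2
          + Torus.viscAdjVar (fun y => Torus.Visc4.conj (G p.1 y) 𝔸) ((fun (_ : ℝ) (_ : UnitAddTorus d) => c) p.1) p.2⟫_ℝ
        + A * ⟪b p.1 p.2, Torus.convect (w p.1) ((fun (_ : ℝ) (_ : UnitAddTorus d) => c) p.1) p.2⟫_ℝ) = fun _ => 0 :=
      funext fun p => hzero p.1 p.2
    rw [this]
    exact integrable_zero _ _ _
  have key := h.ae_integral_inner_lipschitzField_eq (ψ := fun (_ : ℝ) (_ : UnitAddTorus d) => c)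
    (ψ' := fun (_ : ℝ) (_ : UnitAddTorus d) => (0 : EuclideanSpace ℝ d)) hψs hψc hψL hc hψ' hint
  filter_upwards [key] with t ht
  rw [ht]
  have h2 : (∫ τ in Ioc 0 t, ∫ x, (⟪w τ x, (fun (_ : ℝ) (_ : UnitAddTorus d) => (0 : EuclideanSpace ℝ d)) τ x
          + Torus.convect (b τ) ((fun (_ : ℝ) (_ : UnitAddTorus d) => c) τ) x
          + Torus.viscAdjVar (fun y => Torus.Visc4.conj (G τ y) 𝔸) ((fun (_ : ℝ) (_ : UnitAddTorus d) => c) τ) x⟫_ℝ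
        + A * ⟪b τ x, Torus.convect (w τ) ((fun (_ : ℝ) (_ : UnitAddTorus d) => c) τ) x⟫_ℝ)) = 0 := by
    simp_rw [hzero]
    simp
  rw [h2, add_zero]

/-- **A datum orthogonal to the constants stays orthogonal** (L20 §2's cross term `⟪c, w t⟫` vanishes identically: the slow constant
datum `e₂` is a steady state and the fast partner never acquires a mean). -/
theorem _root_.Literature.Analysis.FluidPDE.Torus.IsWeakTensorPassiveVectorDistortedOn.ae_integral_inner_const_eq_zero
    (h : Torus.IsWeakTensorPassiveVectorDistortedOn A T 𝔸 b G w₀ w) (c : EuclideanSpace ℝ d)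
    (hc : ∀ t, Torus.IsDivFree (Torus.distort (G t) (fun _ : UnitAddTorus d => c))) (h0 : ∫ x, ⟪w₀ x, c⟫_ℝ = 0) :
    ∀ᵐ t ∂(volume.restrict (Ioo 0 T)), ∫ x, ⟪w t x, c⟫_ℝ = 0 := by
  filter_upwards [h.ae_integral_inner_const_eq c hc] with t ht
  rw [ht, h0]

/-- **Mean conservation under a modulation datum** (the columns of `G t` are divergence free and smooth on `[0,Tw]`, `IsModulation.piola` /
`.smooth`): for a distorted weak solution on `(0,T)` whose distortion takes values `G t` with `t ∈ [0,Tw]` only (e.g. a CLAMPED frame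
`τ ↦ G (max 0 (min τ Tw))`), every mean is conserved. -/
theorem ae_integral_inner_const_eq_of_window {Tw : ℝ} {Gm : ℝ → UnitAddTorus d → Matrix d d ℝ}
    (hsmooth : ∀ t ∈ Icc 0 Tw, ∀ i j, Torus.IsSmooth (fun y => Gm t y i j))
    (hpiola : ∀ t ∈ Icc 0 Tw, ∀ i, Torus.IsDivFree (fun y => (WithLp.toLp 2 fun c' => Gm t y c' i : EuclideanSpace ℝ d)))
    {ρ : ℝ → ℝ} (hρ : ∀ t, ρ t ∈ Icc 0 Tw) (hG : ∀ t, G t = Gm (ρ t))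
    (h : Torus.IsWeakTensorPassiveVectorDistortedOn A T 𝔸 b G w₀ w) (c : EuclideanSpace ℝ d) :
    ∀ᵐ t ∂(volume.restrict (Ioo 0 T)), ∫ x, ⟪w t x, c⟫_ℝ = ∫ x, ⟪w₀ x, c⟫_ℝ :=
  h.ae_integral_inner_const_eq c fun t => by
    rw [hG t]
    exact isDivFree_distort_const (hsmooth (ρ t) (hρ t)) (hpiola (ρ t) (hρ t)) c

end Summit.AnomalousDissipation.AnomalousDissipation.Theorems.SolenoidalFractalHomogenisation.LagrangianStep.CellClauseMod

end
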